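import Mathlib
import Literature.NumberTheory.LFunctions.Zhang2022.Section5Lemma54PartOne
import HarnessLib

/-!
# Zhang (2022), §5, Lemma 5.4 (i): the SIZE of the implied constant — an explicit bound,
# polynomial in `𝓛₂` and `t₀`, for `K = ∫₀^∞ |Δ″(x)|(x^{3/2} + x³) dx`, kernel-checked

Topic `Literature/NumberTheory/LFunctions/Zhang2022` (Landau–Siegel audit tree; verdict-neutral).
Y. Zhang, *Discrete mean estimates and the Landau–Siegel zero*, arXiv:2211.02515v1 (2022)
[Zhang2022LandauSiegel] — **an unrefereed manuscript under adjudication** (D-0069 width campaign,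
DAG node `Z22:Lem5.4`, PDF p. 28, tex L1523–L1545):

> **Lemma 5.4.** (i). If `1/2 ≤ σ ≤ 2`, then `δ(s) ≪ 𝓛ᶜ|s|⁻²`. …
> *Proof.* (i). Using partial integration twice we obtain
> `δ(s) = (1/(s(s+1)))∫₀^∞ Δ″(x)x^{s+1} dx`. … Thus some upper bounds for `Δ″(x)` analogous to
> Lemma 5.3 can be obtained, and (i) follows.

The tree kernel-checks the STRUCTURE of (i) with free parameters `L₂ ≥ 1`, `t₀`
(`Lemma53.norm_delta514_le`: `‖δ(s)‖ ≤ K/‖s‖²`, `K = ∫₀^∞ ‖Δ″(x)‖(x^{3/2}+x³) dx`,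
`Section5Lemma54PartOne`) and says explicitly that the SIZE `K ≪ 𝓛ᶜ` under the manuscript's
parameter values is not asserted there. This file supplies it, still with free real parameters
(the manuscript's values `𝓛₂ = 𝓛⁴⁰⁰`, `t₀ = 𝓛⁵¹⁹` are substituted in `Section5Lemma54Discharge`):

* (private) the elementary majorants `e^{−y} ≤ n!·y⁻ⁿ`, `e^{−(log x)²/4} ≤ e^{k²}x^{−k}`;
* `Lemma53.Jconst_le_Jconst_one` — `Jₙ(L₂) ≤ Jₙ(1)` for `L₂ ≥ 1`: the constant of the trivial bound
  `‖Δ⁽ⁿ⁾‖ ≤ Jₙ` is ABSOLUTE;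
* `Lemma53.norm_phaseInt_le_rpow_neg_const` — the tree's `exists_norm_phaseInt_le_rpow_neg` with
  its constant KEPT (`C₁ + C₂ + C₃`), and `Lemma53.norm_phaseInt_le_rpow_neg_explicit` — the same
  with the constant made POLYNOMIAL: for `L₂, t₀ ≥ 1`, `x ≥ 1`,
  `‖Δ⁽ⁿ⁾(x)‖ ≤ ((2+e)(4π)ⁿe^{k²} + (e(2k)! + 5ᵏ)Jₙ(1))·(L₂^{2k} + t₀^{2k})·x^{−k}`;
* `Lemma53.integral_norm_phaseInt_two_weight_le_of` — `K ≤ 2J₂ + 2C` whenever `‖Δ″(x)‖ ≤ Cx⁻⁵`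
  on `x ≥ 1` (split `(0,1] ∪ (1,∞)`, `∫₁^∞ x⁻² = 1`);
* `Lemma53.norm_delta514_le_explicit` — **Lemma 5.4 (i) with its size**: for `L₂, t₀ ≥ 1` and
  `1/2 ≤ σ ≤ 2`, `‖δ(s)‖ ≤ (2J₂(1) + 2C₂₅(L₂¹⁰ + t₀¹⁰))/‖s‖²`,
  `C₂₅ = (2+e)(4π)²e²⁵ + (e·10! + 5⁵)J₂(1)` absolute — so the printed `𝓛ᶜ` is a polynomial in
  `𝓛₂, t₀` (degree `10`), i.e. `c = 5190` under `𝓛₂ = 𝓛⁴⁰⁰`, `t₀ = 𝓛⁵¹⁹`.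

What is NOT asserted: anything about Theorems 1–2 of the source or about Landau–Siegel zeros;
nothing here bears on the cell's verdict on (8.24). A proof file: no new definitions, no new facts.

## References

* Y. Zhang, arXiv:2211.02515v1 (2022), §5 Lemma 5.3 (5.9), Lemma 5.4 (i) and its proof, (5.14).
  [cite: Zhang2022LandauSiegel, §5 Lemma 5.4 (i)]
-/

noncomputable section

open Complex Real Set MeasureTheory Filter

namespace Literature.NumberTheory.LFunctions.Zhang2022

namespace Lemma53


/-! ## Elementary majorants -/

/-- `e^{−y} ≤ n!·y^{−n}` for `y > 0` (from `yⁿ/n! ≤ eʸ`). [folklore] -/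
private theorem exp_neg_le_factorial_mul_rpow_neg {y : ℝ} (hy : 0 < y) (n : ℕ) :
    Real.exp (-y) ≤ (n.factorial : ℝ) * y ^ (-(n : ℝ)) := by
  have h := Real.pow_div_factorial_le_exp y hy.le n
  have hfac : (0 : ℝ) < n.factorial := by exact_mod_cast Nat.factorial_pos n
  rw [div_le_iff₀ hfac] at h
  rw [Real.rpow_neg hy.le, Real.rpow_natCast, Real.exp_neg]
  have hyn : 0 < y ^ n := pow_pos hy n
  rw [inv_le_iff_one_le_mul₀ (Real.exp_pos y)]
  calc (1 : ℝ) = y ^ n * (y ^ n)⁻¹ := by field_simp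
    _ ≤ (Real.exp y * n.factorial) * (y ^ n)⁻¹ := by gcongr
    _ = n.factorial * (y ^ n)⁻¹ * Real.exp y := by ring

/-- `e^{−(log x)²/4} ≤ e^{k²}·x^{−k}` for `x > 0` (AM–GM in the exponent). [folklore] -/
private theorem exp_neg_log_sq_div_four_le {x : ℝ} (hx : 0 < x) (k : ℝ) :
    Real.exp (-((Real.log x) ^ 2 / 4)) ≤ Real.exp (k ^ 2) * x ^ (-k) := by
  rw [Real.rpow_def_of_pos hx, ← Real.exp_add]
  apply Real.exp_le_exp.mpr
  nlinarith [sq_nonneg (Real.log x / 2 - k)]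

/-! ## The trivial-bound constant `Jₙ` is absolute for `L₂ ≥ 1` -/

/-- `Jₙ(L₂) ≥ 0`. [cite: Zhang2022LandauSiegel, §5 Lemma 5.4 (i) (proof)] -/
theorem Jconst_nonneg' (L₂ : ℝ) (n : ℕ) : 0 ≤ Jconst L₂ n :=
  integral_nonneg fun u => by positivity

/-- `Jₙ(L₂) ≤ Jₙ(1)` for `L₂ ≥ 1` (`e^{−L₂²u²} ≤ e^{−u²}`): the constant of the trivial bound
`‖Δ⁽ⁿ⁾(x)‖ ≤ Jₙ` is bounded by an ABSOLUTE constant. [cite: Zhang2022LandauSiegel, §5 Lemma 5.4 (i) (proof)] -/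
theorem Jconst_le_Jconst_one {L₂ : ℝ} (hL : 1 ≤ L₂) (n : ℕ) : Jconst L₂ n ≤ Jconst 1 n := by
  unfold Jconst
  refine integral_mono (integrable_bound (by linarith : L₂ ≠ 0) n)
    (integrable_bound one_ne_zero n) fun u => ?_
  have h2 : 0 ≤ (2 * π * (Real.exp u + 1)) ^ n := by positivity
  apply mul_le_mul_of_nonneg_left _ h2
  apply Real.exp_le_exp.mpr
  have hL2 : 1 ≤ L₂ ^ 2 := one_le_pow₀ hL
  nlinarith [sq_nonneg u, mul_le_mul_of_nonneg_right hL2 (sq_nonneg u)]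

/-! ## Super-polynomial decay of `Δ⁽ⁿ⁾` with an explicit constant -/

/-- **Decay of `Δ⁽ⁿ⁾(x)`, the tree's `exists_norm_phaseInt_le_rpow_neg` with its constant KEPT**
(the analogue of (5.9) with `c = 1/2`, `X = √x`, and the trivial bound while `x ≤ max 1 (4t₀²+1)`):
for `L₂ ≥ 1` and `x ≥ 1`, `‖Δ⁽ⁿ⁾(x)‖ ≤ (C₁ + C₂ + C₃)·x^{−k}` with
`C₁ = (2 + e/L₂)(4π)ⁿe^{k²}`, `C₂ = e·Jₙ(L₂)·(2k)!·L₂^{2k}`, `C₃ = Jₙ(L₂)·(max 1 (4t₀²+1))ᵏ`.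
[cite: Zhang2022LandauSiegel, §5 Lemma 5.4 (i) (proof), Lemma 5.3 (5.9)] -/
theorem norm_phaseInt_le_rpow_neg_const {L₂ : ℝ} (hL : 1 ≤ L₂) (t₀ : ℝ) (n k : ℕ)
    {x : ℝ} (hx1 : 1 ≤ x) :
    ‖phaseInt n L₂ t₀ x‖
      ≤ ((2 + Real.exp 1 / L₂) * (4 * π) ^ n * Real.exp ((k : ℝ) ^ 2)
          + Real.exp 1 * Jconst L₂ n * (((2 * k).factorial : ℝ) * L₂ ^ (2 * k))
          + Jconst L₂ n * (max 1 (4 * t₀ ^ 2 + 1)) ^ (k : ℝ)) * x ^ (-(k : ℝ)) := by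
  have hL0 : 0 < L₂ := by linarith
  -- constants
  set M : ℝ := Jconst L₂ n with hM
  have hM0 : 0 ≤ M := Jconst_nonneg' L₂ n
  set x₀ : ℝ := max 1 (4 * t₀ ^ 2 + 1) with hx₀
  have hx₀1 : 1 ≤ x₀ := le_max_left _ _
  set C₁ : ℝ := (2 + Real.exp 1 / L₂) * (4 * π) ^ n * Real.exp ((k : ℝ) ^ 2) with hC₁
  set C₂ : ℝ := Real.exp 1 * M * (((2 * k).factorial : ℝ) * L₂ ^ (2 * k)) with hC₂
  set C₃ : ℝ := M * x₀ ^ (k : ℝ) with hC₃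
  have hx0 : 0 < x := by linarith
  have hxk : 0 < x ^ (-(k : ℝ)) := Real.rpow_pos_of_pos hx0 _
  by_cases hxx : x₀ < x
  · -- the decay range: the analogue of (5.9) with `c = 1/2`, `X = √x`
    have hsx : 0 < Real.sqrt x := Real.sqrt_pos.mpr hx0
    have ht : 2 * t₀ < Real.sqrt x := by
      have h4 : 4 * t₀ ^ 2 + 1 ≤ x₀ := le_max_right _ _
      have : 4 * t₀ ^ 2 < x := by linarith
      calc 2 * t₀ ≤ |2 * t₀| := le_abs_self _
        _ = Real.sqrt ((2 * t₀) ^ 2) := (Real.sqrt_sq_eq_abs _).symm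
        _ < Real.sqrt x := Real.sqrt_lt_sqrt (sq_nonneg _) (by nlinarith)
    have hc : 0 ≤ 1 / 2 * Real.log x := by
      have := Real.log_nonneg hx1; positivity
    have hX : Real.sqrt x ≤ x * Real.exp (-(1 / 2 * Real.log x)) := by
      have e1 : Real.exp (-(1 / 2 * Real.log x)) = x ^ (-(1 / 2 : ℝ)) := by
        rw [Real.rpow_def_of_pos hx0]; congr 1; ring
      rw [e1, Real.sqrt_eq_rpow,
        show x * x ^ (-(1 / 2 : ℝ)) = x ^ (1 : ℝ) * x ^ (-(1 / 2 : ℝ)) by rw [Real.rpow_one],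
        ← Real.rpow_add hx0]
      norm_num
    have hmain := norm_phaseInt_le_caseTwo hL t₀ hx0.le hc hsx hX ht n
    -- the Gaussian-in-log terms
    have hlog : Real.exp (-(1 / 2 * L₂ * Real.log x) ^ 2)
        ≤ Real.exp ((k : ℝ) ^ 2) * x ^ (-(k : ℝ)) := by
      have h1 : Real.exp (-(1 / 2 * L₂ * Real.log x) ^ 2) ≤ Real.exp (-((Real.log x) ^ 2 / 4)) := by
        apply Real.exp_le_exp.mpr
        have hL2 : 1 ≤ L₂ ^ 2 := one_le_pow₀ hL
        nlinarith [sq_nonneg (Real.log x), mul_le_mul_of_nonneg_right hL2 (sq_nonneg (Real.log x))]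
      exact h1.trans (exp_neg_log_sq_div_four_le hx0 k)
    have hT12 : 2 * (4 * π) ^ n * Real.exp (-(1 / 2 * L₂ * Real.log x) ^ 2)
          + (4 * π) ^ n * Real.exp (1 - (1 / 2 * L₂ * Real.log x) ^ 2) / L₂
        ≤ C₁ * x ^ (-(k : ℝ)) := by
      have e2 : (4 * π) ^ n * Real.exp (1 - (1 / 2 * L₂ * Real.log x) ^ 2) / L₂
          = Real.exp 1 / L₂ * (4 * π) ^ n * Real.exp (-(1 / 2 * L₂ * Real.log x) ^ 2) := by
        rw [sub_eq_add_neg, Real.exp_add]; ring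
      rw [e2, hC₁]
      have hpos : 0 ≤ Real.exp 1 / L₂ * (4 * π) ^ n := by positivity
      have hpos' : 0 ≤ 2 * (4 * π) ^ n := by positivity
      have i1 := mul_le_mul_of_nonneg_left hlog hpos
      have i2 := mul_le_mul_of_nonneg_left hlog hpos'
      nlinarith [i1, i2]
    -- the `e^{−√x/L₂}` term
    have hT3 : Real.exp (-(Real.sqrt x / L₂))
        ≤ ((2 * k).factorial : ℝ) * L₂ ^ (2 * k) * x ^ (-(k : ℝ)) := by
      have h := exp_neg_le_factorial_mul_rpow_neg (y := Real.sqrt x / L₂) (by positivity) (2 * k)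
      have e : (Real.sqrt x / L₂) ^ (-((2 * k : ℕ) : ℝ)) = L₂ ^ (2 * k) * x ^ (-(k : ℝ)) := by
        rw [Real.rpow_neg (by positivity), Real.rpow_natCast, div_pow, pow_mul,
          Real.sq_sqrt hx0.le, Real.rpow_neg hx0.le, Real.rpow_natCast]
        field_simp
      rw [e, ← mul_assoc] at h
      exact h
    have hT3' : Real.exp 1 * Jconst L₂ n * Real.exp (-(Real.sqrt x / L₂))
        ≤ C₂ * x ^ (-(k : ℝ)) := by
      rw [hC₂, ← hM, mul_assoc (Real.exp 1 * M)]
      exact mul_le_mul_of_nonneg_left hT3 (by positivity)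
    have h3 : 0 ≤ C₃ * x ^ (-(k : ℝ)) := by positivity
    calc ‖phaseInt n L₂ t₀ x‖ ≤ _ := hmain
      _ ≤ C₁ * x ^ (-(k : ℝ)) + C₂ * x ^ (-(k : ℝ)) := add_le_add hT12 hT3'
      _ ≤ (C₁ + C₂ + C₃) * x ^ (-(k : ℝ)) := by nlinarith
  · -- the compact range `1 ≤ x ≤ x₀`: trivial bound
    have hxx : x ≤ x₀ := not_lt.mp hxx
    have h1 : ‖phaseInt n L₂ t₀ x‖ ≤ M := norm_phaseInt_le hL0.ne' t₀ x n
    have h2 : M ≤ C₃ * x ^ (-(k : ℝ)) := by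
      rw [hC₃, mul_assoc]
      have : 1 ≤ x₀ ^ (k : ℝ) * x ^ (-(k : ℝ)) := by
        rw [Real.rpow_neg hx0.le, ← div_eq_mul_inv, one_le_div (Real.rpow_pos_of_pos hx0 _)]
        exact Real.rpow_le_rpow hx0.le hxx (Nat.cast_nonneg k)
      nlinarith
    have h3 : 0 ≤ (C₁ + C₂) * x ^ (-(k : ℝ)) := by positivity
    nlinarith

/-- **The same decay with the constant made POLYNOMIAL in `L₂, t₀`**: for `L₂ ≥ 1`, `t₀ ≥ 1`,
`x ≥ 1`, `‖Δ⁽ⁿ⁾(x)‖ ≤ ((2+e)(4π)ⁿe^{k²} + (e·(2k)! + 5ᵏ)·Jₙ(1))·(L₂^{2k} + t₀^{2k})·x^{−k}`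
(`Jₙ(L₂) ≤ Jₙ(1)`, `max 1 (4t₀²+1) ≤ 5t₀²`).
[cite: Zhang2022LandauSiegel, §5 Lemma 5.4 (i) (proof), Lemma 5.3 (5.9)] -/
theorem norm_phaseInt_le_rpow_neg_explicit {L₂ t₀ : ℝ} (hL : 1 ≤ L₂) (ht : 1 ≤ t₀) (n k : ℕ)
    {x : ℝ} (hx1 : 1 ≤ x) :
    ‖phaseInt n L₂ t₀ x‖
      ≤ ((2 + Real.exp 1) * (4 * π) ^ n * Real.exp ((k : ℝ) ^ 2)
          + (Real.exp 1 * ((2 * k).factorial : ℝ) + 5 ^ k) * Jconst 1 n)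
        * (L₂ ^ (2 * k) + t₀ ^ (2 * k)) * x ^ (-(k : ℝ)) := by
  have hL0 : 0 < L₂ := by linarith
  have hx0 : 0 < x := by linarith
  have hxk : 0 < x ^ (-(k : ℝ)) := Real.rpow_pos_of_pos hx0 _
  have hM0 : 0 ≤ Jconst L₂ n := Jconst_nonneg' L₂ n
  have hM1 : Jconst L₂ n ≤ Jconst 1 n := Jconst_le_Jconst_one hL n
  have hJ0 : 0 ≤ Jconst 1 n := Jconst_nonneg' 1 n
  have hLk : 1 ≤ L₂ ^ (2 * k) := one_le_pow₀ hL
  have htk0 : 0 ≤ t₀ ^ (2 * k) := by positivity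
  have hLk0 : 0 ≤ L₂ ^ (2 * k) := by positivity
  have hS : 1 ≤ L₂ ^ (2 * k) + t₀ ^ (2 * k) := by linarith
  -- `C₁ ≤ (2+e)(4π)ⁿe^{k²}·S`
  have hA0 : 0 ≤ (2 + Real.exp 1) * (4 * π) ^ n * Real.exp ((k : ℝ) ^ 2) := by positivity
  have hC₁ : (2 + Real.exp 1 / L₂) * (4 * π) ^ n * Real.exp ((k : ℝ) ^ 2)
      ≤ (2 + Real.exp 1) * (4 * π) ^ n * Real.exp ((k : ℝ) ^ 2)
          * (L₂ ^ (2 * k) + t₀ ^ (2 * k)) := by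
    have h1 : Real.exp 1 / L₂ ≤ Real.exp 1 := div_le_self (Real.exp_pos 1).le hL
    calc (2 + Real.exp 1 / L₂) * (4 * π) ^ n * Real.exp ((k : ℝ) ^ 2)
        ≤ (2 + Real.exp 1) * (4 * π) ^ n * Real.exp ((k : ℝ) ^ 2) := by gcongr
      _ = (2 + Real.exp 1) * (4 * π) ^ n * Real.exp ((k : ℝ) ^ 2) * 1 := (mul_one _).symm
      _ ≤ _ := mul_le_mul_of_nonneg_left hS hA0
  -- `C₂ ≤ e(2k)!Jₙ(1)·S`
  have hC₂ : Real.exp 1 * Jconst L₂ n * (((2 * k).factorial : ℝ) * L₂ ^ (2 * k))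
      ≤ Real.exp 1 * ((2 * k).factorial : ℝ) * Jconst 1 n * (L₂ ^ (2 * k) + t₀ ^ (2 * k)) := by
    calc Real.exp 1 * Jconst L₂ n * (((2 * k).factorial : ℝ) * L₂ ^ (2 * k))
        = Real.exp 1 * ((2 * k).factorial : ℝ) * Jconst L₂ n * L₂ ^ (2 * k) := by ring
      _ ≤ Real.exp 1 * ((2 * k).factorial : ℝ) * Jconst 1 n * (L₂ ^ (2 * k) + t₀ ^ (2 * k)) := by
          gcongr; linarith
  -- `C₃ ≤ 5ᵏJₙ(1)·S`
  have hx₀5 : max 1 (4 * t₀ ^ 2 + 1) ≤ 5 * t₀ ^ 2 := by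
    refine max_le (by nlinarith) (by nlinarith)
  have hx₀0 : 0 ≤ max 1 (4 * t₀ ^ 2 + 1) := le_trans zero_le_one (le_max_left _ _)
  have hC₃ : Jconst L₂ n * (max 1 (4 * t₀ ^ 2 + 1)) ^ (k : ℝ)
      ≤ 5 ^ k * Jconst 1 n * (L₂ ^ (2 * k) + t₀ ^ (2 * k)) := by
    rw [Real.rpow_natCast]
    have h1 : (max 1 (4 * t₀ ^ 2 + 1)) ^ k ≤ (5 * t₀ ^ 2) ^ k := pow_le_pow_left₀ hx₀0 hx₀5 k
    have h2 : (5 * t₀ ^ 2) ^ k = 5 ^ k * t₀ ^ (2 * k) := by rw [mul_pow, ← pow_mul]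
    calc Jconst L₂ n * (max 1 (4 * t₀ ^ 2 + 1)) ^ k ≤ Jconst 1 n * (5 ^ k * t₀ ^ (2 * k)) := by
          rw [← h2]; exact mul_le_mul hM1 h1 (by positivity) hJ0
      _ = 5 ^ k * Jconst 1 n * t₀ ^ (2 * k) := by ring
      _ ≤ 5 ^ k * Jconst 1 n * (L₂ ^ (2 * k) + t₀ ^ (2 * k)) := by
          apply mul_le_mul_of_nonneg_left _ (by positivity); linarith
  refine (norm_phaseInt_le_rpow_neg_const hL t₀ n k hx1).trans ?_
  have hsum := add_le_add (add_le_add hC₁ hC₂) hC₃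
  refine (mul_le_mul_of_nonneg_right hsum hxk.le).trans (le_of_eq ?_)
  ring

/-! ## Part (i): the size of `K = ∫₀^∞ ‖Δ″(x)‖(x^{3/2} + x³) dx` -/

/-- **`K ≤ 2J₂ + 2C`** whenever `‖Δ″(x)‖ ≤ C·x⁻⁵` for `x ≥ 1`: split `(0,∞) = (0,1] ∪ (1,∞)`, use the
trivial bound `‖Δ″‖ ≤ J₂` and `x^{3/2} + x³ ≤ 2` on `(0,1]`, and `C x⁻⁵(x^{3/2} + x³) ≤ 2C x⁻²`,
`∫₁^∞ x⁻² dx = 1` on `(1,∞)`. [cite: Zhang2022LandauSiegel, §5 Lemma 5.4 (i) (proof)] -/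
theorem integral_norm_phaseInt_two_weight_le_of {L₂ t₀ C : ℝ} (hL : 1 ≤ L₂) (hC : 0 ≤ C)
    (hdec : ∀ x : ℝ, 1 ≤ x → ‖phaseInt 2 L₂ t₀ x‖ ≤ C * x ^ (-(5 : ℝ))) :
    ∫ x in Ioi (0 : ℝ), ‖phaseInt 2 L₂ t₀ x‖ * (x ^ (3 / 2 : ℝ) + x ^ (3 : ℝ))
      ≤ 2 * Jconst L₂ 2 + 2 * C := by
  have hL0 : 0 < L₂ := by linarith
  set J : ℝ := Jconst L₂ 2 with hJ
  have hJ0 : 0 ≤ J := Jconst_nonneg' L₂ 2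
  set f : ℝ → ℝ := fun x => ‖phaseInt 2 L₂ t₀ x‖ * (x ^ (3 / 2 : ℝ) + x ^ (3 : ℝ)) with hf
  -- integrability of `f` on `(0, ∞)` (as in the tree's `norm_delta514_le`)
  have hI1 := integrableOn_norm_phaseInt_mul_rpow hL t₀ 2 (a := 3 / 2 + 1) (by norm_num)
  have hI2 := integrableOn_norm_phaseInt_mul_rpow hL t₀ 2 (a := 3 + 1) (by norm_num)
  simp only [add_sub_cancel_right] at hI1 hI2
  have hfint : IntegrableOn f (Ioi 0) :=
    (hI1.add hI2).congr (Eventually.of_forall fun x => by simp only [hf, Pi.add_apply]; ring)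
  -- split the domain
  have hsplit : ∫ x in Ioi (0 : ℝ), f x = (∫ x in Ioc (0 : ℝ) 1, f x) + ∫ x in Ioi (1 : ℝ), f x := by
    rw [← Ioc_union_Ioi_eq_Ioi zero_le_one]
    exact setIntegral_union Ioc_disjoint_Ioi_same measurableSet_Ioi
      (hfint.mono_set Ioc_subset_Ioi_self) (hfint.mono_set (Ioi_subset_Ioi zero_le_one))
  -- `(0, 1]`
  have h1 : ∫ x in Ioc (0 : ℝ) 1, f x ≤ 2 * J := by
    have hconst : IntegrableOn (fun _ : ℝ => 2 * J) (Ioc (0 : ℝ) 1) :=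
      integrableOn_const (measure_Ioc_lt_top).ne
    calc ∫ x in Ioc (0 : ℝ) 1, f x ≤ ∫ x in Ioc (0 : ℝ) 1, (2 * J : ℝ) := by
          refine setIntegral_mono_on (hfint.mono_set Ioc_subset_Ioi_self) hconst
            measurableSet_Ioc fun x hx => ?_
          have hx0 : 0 < x := hx.1
          have ha : x ^ (3 / 2 : ℝ) ≤ 1 := Real.rpow_le_one hx0.le hx.2 (by norm_num)
          have hb : x ^ (3 : ℝ) ≤ 1 := Real.rpow_le_one hx0.le hx.2 (by norm_num)
          have hn : ‖phaseInt 2 L₂ t₀ x‖ ≤ J := norm_phaseInt_le hL0.ne' t₀ x 2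
          have hw0 : 0 ≤ x ^ (3 / 2 : ℝ) + x ^ (3 : ℝ) := by positivity
          calc f x = ‖phaseInt 2 L₂ t₀ x‖ * (x ^ (3 / 2 : ℝ) + x ^ (3 : ℝ)) := rfl
            _ ≤ J * (1 + 1) := mul_le_mul hn (add_le_add ha hb) hw0 hJ0
            _ = 2 * J := by ring
      _ = 2 * J := by
          rw [setIntegral_const, Real.volume_real_Ioc_of_le zero_le_one, smul_eq_mul]; ring
  -- `(1, ∞)`
  have h2 : ∫ x in Ioi (1 : ℝ), f x ≤ 2 * C := by
    have hrpow : IntegrableOn (fun x : ℝ => 2 * C * x ^ (-(2 : ℝ))) (Ioi 1) :=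
      (integrableOn_Ioi_rpow_of_lt (by norm_num : (-(2 : ℝ)) < -1) zero_lt_one).const_mul _
    calc ∫ x in Ioi (1 : ℝ), f x ≤ ∫ x in Ioi (1 : ℝ), 2 * C * x ^ (-(2 : ℝ)) := by
          refine setIntegral_mono_on (hfint.mono_set (Ioi_subset_Ioi zero_le_one)) hrpow
            measurableSet_Ioi fun x hx => ?_
          have hx1 : 1 ≤ x := le_of_lt hx
          have hx0 : 0 < x := by linarith
          have hd := hdec x hx1
          have ha : x ^ (3 / 2 : ℝ) ≤ x ^ (3 : ℝ) :=
            Real.rpow_le_rpow_of_exponent_le hx1 (by norm_num)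
          have hw : x ^ (3 / 2 : ℝ) + x ^ (3 : ℝ) ≤ 2 * x ^ (3 : ℝ) := by linarith
          have hw0 : 0 ≤ x ^ (3 / 2 : ℝ) + x ^ (3 : ℝ) := by positivity
          have hC5 : 0 ≤ C * x ^ (-(5 : ℝ)) := by positivity
          have e : x ^ (-(5 : ℝ)) * x ^ (3 : ℝ) = x ^ (-(2 : ℝ)) := by
            rw [← Real.rpow_add hx0]; norm_num
          calc f x = ‖phaseInt 2 L₂ t₀ x‖ * (x ^ (3 / 2 : ℝ) + x ^ (3 : ℝ)) := rfl
            _ ≤ C * x ^ (-(5 : ℝ)) * (2 * x ^ (3 : ℝ)) := mul_le_mul hd hw hw0 hC5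
            _ = 2 * C * (x ^ (-(5 : ℝ)) * x ^ (3 : ℝ)) := by ring
            _ = 2 * C * x ^ (-(2 : ℝ)) := by rw [e]
      _ = 2 * C * ∫ x in Ioi (1 : ℝ), x ^ (-(2 : ℝ)) := MeasureTheory.integral_const_mul _ _
      _ = 2 * C := by
          rw [integral_Ioi_rpow_of_lt (by norm_num : (-(2 : ℝ)) < -1) zero_lt_one, Real.one_rpow]
          norm_num
  calc ∫ x in Ioi (0 : ℝ), f x = (∫ x in Ioc (0 : ℝ) 1, f x) + ∫ x in Ioi (1 : ℝ), f x := hsplit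
    _ ≤ 2 * J + 2 * C := add_le_add h1 h2

/-- **Lemma 5.4 (i) with its size, free parameters**: for `L₂ ≥ 1`, `t₀ ≥ 1`, `1/2 ≤ σ ≤ 2`,
`‖δ(s)‖ ≤ (2J₂(1) + 2·C₂₅·(L₂¹⁰ + t₀¹⁰))/‖s‖²` with the absolute
`C₂₅ = (2+e)(4π)²e²⁵ + (e·10! + 5⁵)J₂(1)` — the constant `𝓛ᶜ` of "`δ(s) ≪ 𝓛ᶜ|s|⁻²`" is a
POLYNOMIAL in `L₂, t₀`. [cite: Zhang2022LandauSiegel, §5 Lemma 5.4 (i)] -/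
theorem norm_delta514_le_explicit {L₂ t₀ : ℝ} (hL : 1 ≤ L₂) (ht : 1 ≤ t₀) {s : ℂ}
    (hσ1 : 1 / 2 ≤ s.re) (hσ2 : s.re ≤ 2) :
    ‖delta514 L₂ t₀ s‖
      ≤ (2 * Jconst 1 2
          + 2 * (((2 + Real.exp 1) * (4 * π) ^ 2 * Real.exp (((5 : ℕ) : ℝ) ^ 2)
              + (Real.exp 1 * ((2 * 5).factorial : ℝ) + 5 ^ 5) * Jconst 1 2)
            * (L₂ ^ (2 * 5) + t₀ ^ (2 * 5)))) / ‖s‖ ^ 2 := by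
  set C : ℝ := ((2 + Real.exp 1) * (4 * π) ^ 2 * Real.exp (((5 : ℕ) : ℝ) ^ 2)
      + (Real.exp 1 * ((2 * 5).factorial : ℝ) + 5 ^ 5) * Jconst 1 2)
    * (L₂ ^ (2 * 5) + t₀ ^ (2 * 5)) with hC
  have hJ0 : 0 ≤ Jconst 1 2 := Jconst_nonneg' 1 2
  have hC0 : 0 ≤ C := by positivity
  have hdec : ∀ x : ℝ, 1 ≤ x → ‖phaseInt 2 L₂ t₀ x‖ ≤ C * x ^ (-(5 : ℝ)) := by
    intro x hx1
    have h := norm_phaseInt_le_rpow_neg_explicit hL ht 2 5 hx1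
    rw [hC]
    exact_mod_cast h
  have hK := integral_norm_phaseInt_two_weight_le_of hL hC0 hdec
  have hJ := Jconst_le_Jconst_one hL 2
  refine (norm_delta514_le hL t₀ hσ1 hσ2).trans ?_
  exact div_le_div_of_nonneg_right (by linarith) (sq_nonneg _)

end Lemma53

end Literature.NumberTheory.LFunctions.Zhang2022
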